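import Summits.BirchSwinnertonDyer.BirchSwinnertonDyer.Theorems.CMKolyvaginAtInertTwoInertOrderSplittingNonMaximal
import Literature.NumberTheory.EllipticCurves.ShaIsogeny
import Literature.NumberTheory.EllipticCurves.SelmerImage
import HarnessLib

/-!
# Route `CMKolyvaginAtInertTwo`, crux `CMKolyvaginExactAtInertTwo` (stmt-BirchSwinnertonDyer-24277):
# the inert-order splitting OF THE SELMER GROUP — `η_*` preserves `Sel_n(E_K/K)` as soon as `η` has
# local points maps, hence `#Sel_{2^M}(E_K/K) = (#Sel_{2^M}(E_K/K)^{σ})²` on the habitat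

Seat `bsd-line-cmk2-p1` g10 (cell `bsd-print-cf2`); helper (`--supports stmt-BirchSwinnertonDyer-24277`).
THEOREMS ONLY: no definition, no named fact, no `sorry`; no item is closed; BSD is not proved by this.
Memo `Cruxes/CMExactDescentAtTwo/MEMO-inert-order-splitting.md` §5, stub S1: this file REDUCES S1 to the
one geometric input `HasLocalPointsMaps (W⁄K) (W⁄K) η` (the tree's Prop of `ShaIsogeny`: `η` extends
`Γ`-equivariantly to the points over every completion — what `Isogeny.hasLocalPointsMaps` provides once
`η` is packaged as an `Isogeny`, i.e. once its algebraicity `IsAlgebraicOn` is transported from Cox's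
`ι₀(ω) ∈ End_{ℚ̄}(E)`).

* `torsionH1ToH1_resH1Hom_eq_galH1Map` — the square `H¹(K,E[n]) → H¹(K,E)` commutes with `η_*` / `H¹(η)`.
* `resH1Hom_mem_selmerGroup_of_hasLocalPointsMaps` — **`η_*` maps `Sel_n(E/K)` into itself** when `η` has
  local points maps (`Sel_n = (H¹(K,E[n]) → H¹(K,E))⁻¹ Ш`, `ShaIsogeny.galH1Map_mem_sha`).
* `natCard_selmer_eq_sq_of_hasLocalPointsMaps` — on the habitat data of
  `exists_cmGenerator_splitting_of_cmInert_two` (all of `H₂`), for a TOTALLY COMPLEX `K` (so that `σ_*`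
  preserves the Selmer group, `conjAct_mem_selmerGroup`) and `η` with local points maps:
  **`#Sel_{2^M}(E_K/K) = (#Sel_{2^M}(E_K/K)^{σ})²`** — the exact Selmer splitting of the Morita frame.

References: Milne, *ADT*, I.§6–7 [MilneADT2006]; Silverman *AEC* X.§4 [SilvermanAEC2009]; Lang, *Elliptic
Functions*, Ch. 10 §4 [Lang1987].
-/

-- single-conjunct summit: `Summit.BirchSwinnertonDyer.BirchSwinnertonDyer.…` repeats the name by design
set_option linter.dupNamespace false
set_option autoImplicit false

noncomputable section

open scoped Classical

namespace Summit.BirchSwinnertonDyer.BirchSwinnertonDyer.Theorems.InertOrderSplittingHabitat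

open WeierstrassCurve Field NumberField
open Literature.NumberTheory.EllipticCurves Literature.NumberTheory.EllipticCurves.Rank1Residual
open Literature.NumberTheory.GaloisRepresentations

universe u

/-! ## §1 `η_*` and `H¹(η)` are compatible with `H¹(K, E[n]) → H¹(K, E)` -/

section Functorial

variable {K : Type u} [Field K] (V : WeierstrassCurve K) (n : ℤ)

/-- **`H¹(K,E[n]) → H¹(K,E)` intertwines `η_*` and `H¹(η)`**: both composites are the map of the compatible
pair `(id, E[n] → E(K̄), P ↦ ηP)`. [cite: SilvermanAEC2009, X.§4] -/
theorem torsionH1ToH1_resH1Hom_eq_galH1Map (η : AddMonoid.End (geomPoints V))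
    (hη : ∀ (γ : absoluteGaloisGroup K) (P : geomPoints V), η (γ • P) = γ • η P)
    (ηn : geomTorsion V n →+ geomTorsion V n) (hηn : ∀ P : geomTorsion V n, (ηn P : geomPoints V) = η P)
    (hηnG : ∀ (x : absoluteGaloisGroup K) (P : geomTorsion V n),
      ηn (ContinuousMonoidHom.id (absoluteGaloisGroup K) x • P) = x • ηn P)
    (x : galH1Torsion V n) :
    torsionH1ToH1 V n (resH1Hom (ContinuousMonoidHom.id _) ηn hηnG x) =
      galH1Map η hη (torsionH1ToH1 V n x) := by
  have key : (torsionH1ToH1 V n).comp (resH1Hom (ContinuousMonoidHom.id _) ηn hηnG) =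
      (galH1Map η hη).comp (torsionH1ToH1 V n) := by
    rw [torsionH1ToH1_eq_resH1Hom, galH1Map, resH1Hom_comp, resH1Hom_comp]
    exact resH1Hom_congr rfl (AddMonoidHom.ext fun P ↦ hηn P) _ _
  exact congrArg (fun F : galH1Torsion V n →+ V.galH1 ↦ F x) key

variable [NumberField K]

/-- **`η_*` preserves the Selmer group** when `η` has local points maps: `Sel_n(E/K)` is the preimage
of `Ш(E/K)` (`selmerGroup_eq_comap_sha`) and `H¹(η)` preserves `Ш` (`galH1Map_mem_sha`).
[cite: MilneADT2006, I.§7 (proof of Lemma 7.1)] [cite: SilvermanAEC2009, X.§4] -/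
theorem resH1Hom_mem_selmerGroup_of_hasLocalPointsMaps (η : AddMonoid.End (geomPoints V))
    (hη : ∀ (γ : absoluteGaloisGroup K) (P : geomPoints V), η (γ • P) = γ • η P)
    (hloc : HasLocalPointsMaps V V η)
    (ηn : geomTorsion V n →+ geomTorsion V n) (hηn : ∀ P : geomTorsion V n, (ηn P : geomPoints V) = η P)
    (hηnG : ∀ (x : absoluteGaloisGroup K) (P : geomTorsion V n),
      ηn (ContinuousMonoidHom.id (absoluteGaloisGroup K) x • P) = x • ηn P)
    {x : galH1Torsion V n} (hx : x ∈ selmerGroup V n) :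
    resH1Hom (ContinuousMonoidHom.id _) ηn hηnG x ∈ selmerGroup V n := by
  rw [selmerGroup_eq_comap_sha, AddSubgroup.mem_comap] at hx ⊢
  rw [torsionH1ToH1_resH1Hom_eq_galH1Map V n η hη ηn hηn hηnG]
  exact galH1Map_mem_sha η hη hloc hx

end Functorial

/-! ## §2 The exact Selmer splitting on the habitat -/

section Selmer

variable (W : WeierstrassCurve ℚ) [W.IsElliptic] {K : Type} [Field K] [NumberField K]
variable {σ : K ≃ₐ[ℚ] K} {c₀ : absoluteGaloisGroup ℚ}

/-- **`#Sel_{2^M}(E_K/K) = (#Sel_{2^M}(E_K/K)^{σ})²` on `H₂`**, for a totally complex `K ∋ √d_F` with an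
involution `σ` lifted by complex conjugation and a `3`-cycle in `ρ̄₂(Γ_K)`, GRANTED that the equivariant CM
generator `η` of `exists_cmGenerator_splitting_of_cmInert_two` has local points maps (stub S1's residue).
Since `η` is existentially produced, the input is displayed as: EVERY `Γ_K`-equivariant additive
endomorphism of `E_K(K̄)` with `η² + mη = c` has local points maps (true for isogenies:
`Isogeny.hasLocalPointsMaps`). [cite: Lang1987, Ch. 10 §4, Remark] [cite: MilneADT2006, I.§7] -/
theorem natCard_selmer_eq_sq_of_hasLocalPointsMaps (hCM : W.HasCM) (hin : CMInert W 2)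
    (hsurj : W.HasSurjectiveModNGaloisRep 2) (hK : ∀ w : InfinitePlace K, w.IsComplex)
    (hF : IsSquare (algebraMap ℚ K (cmFieldDiscrOfJ W.j)))
    (hc₀ : IsComplexConjugation (Rat.castHom ℝ) c₀) (hσ : σ * σ = 1)
    (hτ : IsLiftOfAut σ (absGaloisTransport (K := ℚ) (L := K) c₀).toRingEquiv)
    {z : absoluteGaloisGroup K}
    (hz : ∀ P : geomPoints (W.baseChange K), (2 : ℤ) • P = 0 → z • P = P → P = 0)
    (hloc : ∀ (η : AddMonoid.End (geomPoints (W.baseChange K))) (m c : ℤ),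
      (∀ P, η (η P) + m • η P = c • P) →
      (∀ (γ : absoluteGaloisGroup K) (P : geomPoints (W.baseChange K)), γ • η P = η (γ • P)) →
        HasLocalPointsMaps (W.baseChange K) (W.baseChange K) η)
    (M : ℕ) :
    Nat.card (selmerGroup (W.baseChange K) ((2 : ℤ) ^ M)) =
      Nat.card {x : selmerGroup (W.baseChange K) ((2 : ℤ) ^ M) //
        conjAct W σ _ (x : galH1Torsion (W.baseChange K) ((2 : ℤ) ^ M)) = x} ^ 2 := by
  obtain ⟨m, c, η, -, -, hrel, hη, hpack⟩ :=
    exists_cmGenerator_splitting_of_cmInert_two W hCM hin hsurj hF hc₀ hσ hτ hz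
  obtain ⟨ηn, hηnG, hηn, hS⟩ := hpack M
  refine hS (selmerGroup (W.baseChange K) ((2 : ℤ) ^ M)) (fun x hx ↦ conjAct_mem_selmerGroup W hK σ _ hx)
    fun x hx ↦ ?_
  exact resH1Hom_mem_selmerGroup_of_hasLocalPointsMaps (W.baseChange K) _ η (fun γ P ↦ (hη γ P).symm)
    (hloc η m c hrel hη) ηn hηn hηnG hx

end Selmer

end Summit.BirchSwinnertonDyer.BirchSwinnertonDyer.Theorems.InertOrderSplittingHabitat
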